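import Literature.NumberTheory.Weil1964.ArchMetaplecticSplittingsHolds
import HarnessLib

/-!
# Folland's quotient character `q : Mp^𝓢(W) → S¹`, `q(y) = C(y)² · det P(proj y)`, with kernel `Mp₂(W)`

Topic `NumberTheory/Weil1964`; namespace `Literature.NumberTheory.Weil1964.MpS`.  KERNEL ONLY: one definition with
body (`quot`) and theorems; no record, no hypothesis, no `sorry`.

For `y ∈ Mp^𝓢(W)` (`MpS σ`: Heisenberg-covariant topological automorphisms of `𝓢(ℝ^σ)` with unitary `L²`-lifts, an
`S¹`-extension of `Sp(W)`, `ArchMetaplecticExtension`) put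

  `quot y := C(y)² · det P(proj y)`,

`C(y) = ⟪k₀, y k₀⟫` Folland's vacuum coefficient (`MpS.vac`), `P` his block (4.16) (`Sp.follandP`).  Folland's
normalisation `IsMetaplectic y` IS `quot y = 1`, and his Theorem (4.37) — in the tree `folland1989_Thm_4_37_ab_holds`
(over every `g` there is a metaplectic element) and `folland1989_Thm_4_37_c_holds` (metaplectic elements are closed
under products) — says exactly that **`quot` is a HOMOMORPHISM `Mp^𝓢(W) → ℂˣ` with kernel `Mp₂(W)`**
(`quot_mul`, `quot_eq_one_iff`), unimodular (`norm_quot`), `quot (c · y) = c² quot y` (`quot_unitScalar_mul`),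
conjugation invariant (`quot_conj`): it identifies `Mp^𝓢(W)/Mp₂(W) ≅ S¹` (`c ↦ c²` on the scalars).

USE (the lever of the Siegel-parabolic normalisation of a splitting, `quot_sq_eq_of_conj`): if a conjugate
`z y z⁻¹` of `y` is `u · m` with `m` metaplectic — e.g. `m` a product of a Levi element `m(a, ᵗa⁻¹)` with `det a > 0`
and a Siegel chirp, `isMetaplectic_levi_mul_unip` — then `u² = quot y`.  [Folland1989, §4.2 Thm. (4.37), p. 161
L12–16 (the quotient by `±1`; Prop. (4.40))]; the `det^{1/2}` phenomenon of [Adams2007, §3, Rem. 5.6].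

## References

* [Folland1989] G. B. Folland, *Harmonic Analysis in Phase Space*, Princeton UP 1989, §4.2 (4.36)–(4.38), Thm. (4.37),
  p. 161, Prop. (4.40).
* [Adams2007] J. Adams, *The theta correspondence over ℝ*, World Scientific 2007, §3, §5 Rem. 5.6.
-/

set_option autoImplicit false

noncomputable section

open Matrix Complex

namespace Literature.NumberTheory.Weil1964

open Literature.Analysis.SegalBargmann Literature.RepresentationTheory.HeisenbergGroup

namespace MpS

variable {σ : Type*} [Fintype σ] [DecidableEq σ]

/-! ## 1. The quotient value and its algebra -/

/-- **Folland's quotient value** `quot y = C(y)² · det P(proj y)` (`= 1` exactly on `Mp₂(W)`).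
[cite: Folland1989, §4.2 (4.36)–(4.37)] -/
def quot (y : MpS σ) : ℂ := vac y ^ 2 * (Sp.follandP (proj y)).det

/-- `IsMetaplectic y ↔ quot y = 1` (definitions). [cite: Folland1989, §4.2 Thm. (4.37)] -/
theorem isMetaplectic_iff_quot (y : MpS σ) : IsMetaplectic y ↔ quot y = 1 := Iff.rfl

/-- `quot m = 1` for metaplectic `m`. [cite: Folland1989, §4.2 Thm. (4.37)] -/
theorem IsMetaplectic.quot_eq_one {m : MpS σ} (hm : IsMetaplectic m) : quot m = 1 := hm

/-- `quot 1 = 1`. [cite: Folland1989, §4.2 (4.36)] -/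
@[simp] theorem quot_one : quot (1 : MpS σ) = 1 := isMetaplectic_one

/-- `quot (c · y) = c² · quot y`. [cite: Folland1989, §4.2 (4.36)] -/
theorem quot_unitScalar_mul (c : ℂ) (hc : ‖c‖ = 1) (y : MpS σ) :
    quot (unitScalar c hc * y) = c ^ 2 * quot y := by
  rw [quot, quot, vac_unitScalar_mul, map_mul, proj_unitScalar, one_mul]
  ring

/-- `quot (c · 1) = c²`. [cite: Folland1989, §4.2 (4.36)] -/
theorem quot_unitScalar (c : ℂ) (hc : ‖c‖ = 1) : quot (unitScalar (σ := σ) c hc) = c ^ 2 := by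
  rw [← mul_one (unitScalar c hc), quot_unitScalar_mul, quot_one, mul_one]

/-- `quot (−1) = 1`. [cite: Folland1989, §4.2 p. 161] -/
@[simp] theorem quot_negOne : quot (negOne : MpS σ) = 1 := by
  rw [negOne, quot_unitScalar]; norm_num

/-- `‖quot y‖ = 1` for every `y` (`‖C(y)‖² ‖det P‖ = 1`). [cite: Folland1989, §4.2 (4.36), Thm. (4.37)] -/
theorem norm_quot (y : MpS σ) : ‖quot y‖ = 1 := by
  rw [quot, norm_mul, norm_pow]
  exact norm_vac_sq_mul_norm_det_eq_one y

/-- `quot y ≠ 0`. [cite: Folland1989, §4.2 (4.36)] -/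
theorem quot_ne_zero (y : MpS σ) : quot y ≠ 0 := fun h => by
  have h1 := norm_quot y
  rw [h, norm_zero] at h1
  exact zero_ne_one h1

/-- Every `y` is `c · m` with `m` metaplectic over the same point and `c` unimodular (Thm. (4.37)(a)(b) + Schur).
[cite: Folland1989, §4.2 Thm. (4.37), (4.23)] -/
theorem exists_eq_unitScalar_mul_isMetaplectic (y : MpS σ) :
    ∃ (c : ℂ) (hc : ‖c‖ = 1) (m : MpS σ), IsMetaplectic m ∧ proj m = proj y ∧ y = unitScalar c hc * m := by
  obtain ⟨m, hm, hmet⟩ := folland1989_Thm_4_37_ab_holds σ (proj y)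
  obtain ⟨c, hc, h⟩ := exists_eq_unitScalar_mul_of_proj_eq (x := m) (y := y) hm
  exact ⟨c, hc, m, hmet, hm, h⟩

/-! ## 2. `quot` is a homomorphism with kernel `Mp₂(W)` -/

/-- **`quot (x y) = quot x · quot y`** — Folland's Theorem (4.37)(c) in quotient form. [cite: Folland1989, §4.2 Thm. (4.37)(c), p. 161] -/
theorem quot_mul (x y : MpS σ) : quot (x * y) = quot x * quot y := by
  obtain ⟨c, hc, m, hm, -, rfl⟩ := exists_eq_unitScalar_mul_isMetaplectic x
  obtain ⟨c', hc', m', hm', -, rfl⟩ := exists_eq_unitScalar_mul_isMetaplectic y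
  have hmm' : IsMetaplectic (m * m') := folland1989_Thm_4_37_c_holds σ m m' hm hm'
  have h1 : unitScalar c hc * m * (unitScalar c' hc' * m') = unitScalar c hc * unitScalar c' hc' * (m * m') := by
    rw [mul_assoc, ← mul_assoc m, ← unitScalar_mul_comm c' hc' m, mul_assoc, mul_assoc]
  rw [h1, unitScalar_mul_unitScalar, quot_unitScalar_mul, quot_unitScalar_mul, quot_unitScalar_mul, hm.quot_eq_one,
    hm'.quot_eq_one, hmm'.quot_eq_one]
  ring

/-- **The quotient character** `Mp^𝓢(W) →* ℂˣ`. [cite: Folland1989, §4.2 Thm. (4.37), Prop. (4.40)] -/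
def quotHom : MpS σ →* ℂˣ where
  toFun y := Units.mk0 (quot y) (quot_ne_zero y)
  map_one' := Units.ext quot_one
  map_mul' x y := Units.ext (by simp only [Units.val_mk0, Units.val_mul, quot_mul])

/-- `quotHom y = quot y`. [cite: Folland1989, §4.2 Thm. (4.37)] -/
@[simp] theorem coe_quotHom (y : MpS σ) : ((quotHom y : ℂˣ) : ℂ) = quot y := rfl

/-- `quot y⁻¹ = (quot y)⁻¹`. [cite: Folland1989, §4.2 Thm. (4.37)] -/
theorem quot_inv (y : MpS σ) : quot y⁻¹ = (quot y)⁻¹ := by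
  have h := congrArg (fun u : ℂˣ => (u : ℂ)) (map_inv quotHom y)
  simpa only [coe_quotHom, Units.val_inv_eq_inv_val] using h

/-- **Conjugation invariance**: `quot (z y z⁻¹) = quot y`. [cite: Folland1989, §4.2 Thm. (4.37)] -/
theorem quot_conj (z y : MpS σ) : quot (z * y * z⁻¹) = quot y := by
  rw [quot_mul, quot_mul, quot_inv, mul_comm (quot z), mul_assoc, mul_inv_cancel₀ (quot_ne_zero z), mul_one]

/-- **Kernel**: `quot y = 1 ↔ y ∈ Mp₂(W)`. [cite: Folland1989, §4.2 Thm. (4.37), p. 161] -/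
theorem quot_eq_one_iff_mem_Mp₂ (y : MpS σ) : quot y = 1 ↔ y ∈ Mp₂ σ := by
  rw [← isMetaplectic_iff_quot, Mp₂.mem_iff (folland1989_Thm_4_37_ab_holds σ) (folland1989_Thm_4_37_c_holds σ)]

/-! ## 3. The lever: reading `quot` off a metaplectic conjugate -/

/-- **If a conjugate of `y` is `u · m` with `m` metaplectic then `u² = quot y`.** [cite: Folland1989, §4.2 Thm. (4.37), p. 161 L12–16] -/
theorem sq_eq_quot_of_conj_eq {y z m : MpS σ} {u : ℂ} (hu : ‖u‖ = 1) (hm : IsMetaplectic m)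
    (h : z * y * z⁻¹ = unitScalar u hu * m) : u ^ 2 = quot y := by
  have h1 := quot_conj z y
  rw [h, quot_unitScalar_mul, hm.quot_eq_one, mul_one] at h1
  exact h1

/-- Same, unconjugated: `y = u · m` with `m` metaplectic gives `u² = quot y`. [cite: Folland1989, §4.2 Thm. (4.37)] -/
theorem sq_eq_quot_of_eq {y m : MpS σ} {u : ℂ} (hu : ‖u‖ = 1) (hm : IsMetaplectic m)
    (h : y = unitScalar u hu * m) : u ^ 2 = quot y := by
  rw [h, quot_unitScalar_mul, hm.quot_eq_one, mul_one]

/-- **The standard Siegel-parabolic implementers are metaplectic**: a Levi element `m(a, d)` with `det a > 0` followed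
by a Siegel chirp `n(b)`. [cite: Folland1989, §4.2 (4.24)–(4.25), Thm. (4.37); Adams2007, §5 Rem. 5.6] -/
theorem isMetaplectic_levi_mul_unip (a d : (σ → ℝ) ≃ₗ[ℝ] (σ → ℝ))
    (had : ∀ x y, dotPairing σ (a x) (d y) = dotPairing σ x y)
    (hdet : 0 < LinearMap.det (a : (σ → ℝ) →ₗ[ℝ] (σ → ℝ)))
    (b : (σ → ℝ) →ₗ[ℝ] (σ → ℝ)) (hb : ∀ x x', dotPairing σ x (b x') = dotPairing σ x' (b x)) :
    IsMetaplectic (levi a d had * unip b hb) :=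
  folland1989_Thm_4_37_c_holds σ _ _ ((isMetaplectic_levi_iff_det_pos a d had).2 hdet)
    (isGaussCovariant_unip b hb).isMetaplectic

/-- … hence `quot (m(a,d) n(b)) = 1` for `det a > 0`. [cite: Folland1989, §4.2 Thm. (4.37)] -/
theorem quot_levi_mul_unip (a d : (σ → ℝ) ≃ₗ[ℝ] (σ → ℝ))
    (had : ∀ x y, dotPairing σ (a x) (d y) = dotPairing σ x y)
    (hdet : 0 < LinearMap.det (a : (σ → ℝ) →ₗ[ℝ] (σ → ℝ)))
    (b : (σ → ℝ) →ₗ[ℝ] (σ → ℝ)) (hb : ∀ x x', dotPairing σ x (b x') = dotPairing σ x' (b x)) :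
    quot (levi a d had * unip b hb) = 1 :=
  (isMetaplectic_levi_mul_unip a d had hdet b hb).quot_eq_one

/-- `quot (m(a, d)) = 1` for `det a > 0`. [cite: Folland1989, §4.2 (4.24), Thm. (4.37)] -/
theorem quot_levi_of_det_pos (a d : (σ → ℝ) ≃ₗ[ℝ] (σ → ℝ))
    (had : ∀ x y, dotPairing σ (a x) (d y) = dotPairing σ x y)
    (hdet : 0 < LinearMap.det (a : (σ → ℝ) →ₗ[ℝ] (σ → ℝ))) : quot (levi a d had) = 1 :=
  ((isMetaplectic_levi_iff_det_pos a d had).2 hdet).quot_eq_one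

/-- `quot (n(b)) = 1`. [cite: Folland1989, §4.2 (4.25), Thm. (4.37)] -/
theorem quot_unip (b : (σ → ℝ) →ₗ[ℝ] (σ → ℝ)) (hb : ∀ x x', dotPairing σ x (b x') = dotPairing σ x' (b x)) :
    quot (unip b hb) = 1 :=
  (isGaussCovariant_unip b hb).isMetaplectic.quot_eq_one

/-- **On Folland's compact elements `quot` is `det`**: `quot (μ₀(u)) = det u` (`C(μ₀ u) = 1`, `P(realify u) = u`) —
the restriction of the quotient character to `U(σ)` is the determinant. [cite: Folland1989, Prop. (4.39), (4.16)] -/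
theorem quot_unitary (u : Matrix.unitaryGroup σ ℂ) : quot (unitary u) = (u : Matrix σ σ ℂ).det := by
  rw [quot, vac_unitary, one_pow, one_mul, proj_unitary, Sp.follandP_realifySp]

/-- `quot (y x) = quot (x y)`. [cite: Folland1989, §4.2 Thm. (4.37)] -/
theorem quot_mul_comm (x y : MpS σ) : quot (y * x) = quot (x * y) := by
  rw [quot_mul, quot_mul, mul_comm]

end MpS

end Literature.NumberTheory.Weil1964
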